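import Summits.ABC.ABC.Theorems.TwistAmplificationSharpCountSandwichCounting

/-!
# The sandwich `TwistAmplification.SharpCountSandwich` (stmt-ABC-2793)

`SharpCountSandwich_proof : ABC → MazurKaneLaw →` for every `3 < κ < 6 < σ` and `ε > 0` there is `C` such
that every finite set `S` of Frey–twist window data `(a,b,c,d)` — `(a,b,c)` an abc triple, `d = 1` or a prime
not dividing `abc`, `rad(abc) d² ≤ X`, `κ log(rad(abc) d²) ≤ 6 log(cd) ≤ σ log(rad(abc) d²)` — has
`#S ≤ C · X^{1-κ/6+ε}` (`X ≥ 1`). This is the calibration ("honesty clause") of route TwistAmplification: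
together with `FreyAmplification` it shows that the sharp Frey-window count carries exactly abc (pointwise)
and Mazur's law below `2` (statistically).

## Proof (file `…Counting` and this file)

* **Flatness, pointwise** (`flat_ineq`, `datum_bounds`). With `r = rad(abc)`, the two window constraints
  `r d² ≤ X` and `κ log(r d²) ≤ 6 log(cd)` combine, with weights `2 - κ/3` and `κ/3 - 1`, into
  `d ≤ X^{1-κ/6} · c / r`; moreover `r ≤ X` and `r ≤ c^{6/κ}` (quality `≥ κ/6 > 1/2`). This is the pointwise
  form of the exponent identity `(1-q+η)/(1+2η) = 1-κ/6` (independent of the quality `q`) of the item's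
  docstring; no case distinction between the regimes `M^{1+2η} ≶ X` is needed.
* **Fibering** (`card_le_sum_image_of_fiber_bound`). Hence `#S ≤ X^{1-κ/6} Σ_T c_T / r_T`, the sum over the
  finset `F` of abc triples `T` occurring in `S` (`d ≥ 1` injects each fibre into `{1, …, ⌊X^{1-κ/6} c/r⌋}`).
* **Mazur–Kane in finset form** (`finset_card_le_of_mazurKaneLaw`). The set of abc triples with `c ≤ N`,
  `rad ≤ c^s` is finite (`a, b ≤ c ≤ N`), so the route's `ncard` statement bounds every finset of such triples.
* **Weighted Mazur–Kane sum** (`level_sum_le`). `Σ_{T ∈ F} c_T/r_T ≤ m · 4AK (log₂ N₀ + 1) N₀^{2ε₁+δ}` where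
  `N₀ = ⌊K X^{1+ε₁}⌋ + 1` bounds every `c` (abc with exponent `ε₁`: `c ≤ K r^{1+ε₁} ≤ K X^{1+ε₁}`), the grid is
  `s_k = 1 + kδ`, `k = 1..m`, `m = ⌈(6/κ-1)/ε₁⌉`, `mδ = 6/κ - 1` (so `δ ≤ ε₁`, `1 < s_k < 2`), and `A` is the
  sum of the Mazur–Kane constants `C(s_k, ε₁)`.
* **Clean-up.** `log₂ N₀ + 1 ≤ (2/ε₁ + 1) N₀^{ε₁}`, `N₀ ≤ 2K X^{1+ε₁}`, and with `ε₁ = min(ε,1)/16` the total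
  exponent `(1+ε₁) · 4ε₁ ≤ ε`, giving `#S ≤ C X^{1-κ/6+ε}` with `C = m · 4AK(2/ε₁+1) · (2K)^{4ε₁}`.

The hypotheses `6 log(cd) ≤ σ log(r d²)`, `d` prime and `d ∤ abc` of the window predicate are not used (the
bound holds for the larger set of data). Sources: the item's docstring (planner), Kane arXiv:1104.2635 (the
form of `MazurKaneLaw`); everything else is Mathlib.
-/

-- `Summit.<Summit>.<Problem>` is the mandated summit-side namespace (CONVENTIONS §2); for the
-- single-conjunct summit `ABC` the two coincide, so the duplicate `ABC.ABC` is deliberate.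
set_option linter.dupNamespace false

namespace Summit.ABC.ABC.Theorems

open Literature.NumberTheory.DiophantineGeometry

namespace SharpCountSandwich

/-! ## The pointwise flatness inequality -/

/-- **Flatness (linear form).** From `u + 2w ≤ L`, `κ(u + 2w) ≤ 6(v + w)`, `w ≥ 0` and `3 < κ < 6`:
`w ≤ (1 - κ/6) L + v - u` (weights `2 - κ/3` on the first, `κ/3 - 1` on the second constraint) and
`κ u ≤ 6 v`. [folklore] -/
theorem flat_ineq {κ u v w L : ℝ} (hκ3 : 3 < κ) (hκ6 : κ < 6) (hw : 0 ≤ w) (h1 : u + 2 * w ≤ L)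
    (h2 : κ * (u + 2 * w) ≤ 6 * (v + w)) :
    w ≤ (1 - κ / 6) * L + v - u ∧ u * κ ≤ v * 6 := by
  have h3 : (1 - κ / 6) * (u + 2 * w) ≤ (1 - κ / 6) * L :=
    mul_le_mul_of_nonneg_left h1 (by linarith)
  have h4 : 0 ≤ (κ - 3) * w := mul_nonneg (by linarith) hw
  constructor
  · linarith
  · linarith

/-- **Flatness for a window datum.** For an abc triple `(a,b,c)` with radical `r`, an integer `d ≥ 1`, and
`X ≥ 1` with `r d² ≤ X` and `κ log(r d²) ≤ 6 log(c d)` (`3 < κ < 6`):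
`d ≤ X^{1-κ/6} c / r`, `r ≤ X` and `r ≤ c^{6/κ}`. [folklore] -/
theorem datum_bounds {κ X : ℝ} (hκ3 : 3 < κ) (hκ6 : κ < 6) (hX : 1 ≤ X) {a b c d : ℕ}
    (ht : IsABCTriple a b c) (hd : 1 ≤ d)
    (hW1 : ((rad a b c : ℕ) : ℝ) * (d : ℝ) ^ 2 ≤ X)
    (hW2 : κ * Real.log (((rad a b c : ℕ) : ℝ) * (d : ℝ) ^ 2) ≤ 6 * Real.log ((c : ℝ) * (d : ℝ))) :
    (d : ℝ) ≤ X ^ (1 - κ / 6) * (c : ℝ) / ((rad a b c : ℕ) : ℝ) ∧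
    ((rad a b c : ℕ) : ℝ) ≤ X ∧
    ((rad a b c : ℕ) : ℝ) ≤ (c : ℝ) ^ (6 / κ) := by
  have hr2 : (2 : ℝ) ≤ ((rad a b c : ℕ) : ℝ) := by exact_mod_cast ht.two_le_rad
  have hc2 : (2 : ℝ) ≤ (c : ℝ) := by exact_mod_cast ht.two_le
  have hd1 : (1 : ℝ) ≤ (d : ℝ) := by exact_mod_cast hd
  have hr0 : (0 : ℝ) < ((rad a b c : ℕ) : ℝ) := by linarith
  have hc0 : (0 : ℝ) < (c : ℝ) := by linarith
  have hd0 : (0 : ℝ) < (d : ℝ) := by linarith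
  have hX0 : (0 : ℝ) < X := by linarith
  have hκ0 : (0 : ℝ) < κ := by linarith
  have hw : 0 ≤ Real.log (d : ℝ) := Real.log_nonneg hd1
  have e1 : Real.log (((rad a b c : ℕ) : ℝ) * (d : ℝ) ^ 2) =
      Real.log ((rad a b c : ℕ) : ℝ) + 2 * Real.log (d : ℝ) := by
    rw [Real.log_mul hr0.ne' (by positivity), Real.log_pow]
    push_cast
    ring
  have e2 : Real.log ((c : ℝ) * (d : ℝ)) = Real.log (c : ℝ) + Real.log (d : ℝ) :=
    Real.log_mul hc0.ne' hd0.ne'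
  have h1 : Real.log ((rad a b c : ℕ) : ℝ) + 2 * Real.log (d : ℝ) ≤ Real.log X := by
    rw [← e1]
    exact Real.log_le_log (by positivity) hW1
  have h2 : κ * (Real.log ((rad a b c : ℕ) : ℝ) + 2 * Real.log (d : ℝ)) ≤
      6 * (Real.log (c : ℝ) + Real.log (d : ℝ)) := by
    rw [← e1, ← e2]
    exact hW2
  obtain ⟨key, key2⟩ := flat_ineq hκ3 hκ6 hw h1 h2
  refine ⟨?_, ?_, ?_⟩
  · calc (d : ℝ) = Real.exp (Real.log (d : ℝ)) := (Real.exp_log hd0).symm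
      _ ≤ Real.exp ((1 - κ / 6) * Real.log X + Real.log (c : ℝ) - Real.log ((rad a b c : ℕ) : ℝ)) :=
          Real.exp_le_exp.mpr key
      _ = X ^ (1 - κ / 6) * (c : ℝ) / ((rad a b c : ℕ) : ℝ) := by
          rw [Real.exp_sub, Real.exp_add, Real.exp_log hc0, Real.exp_log hr0,
            Real.rpow_def_of_pos hX0, mul_comm (Real.log X)]
  · calc ((rad a b c : ℕ) : ℝ) = ((rad a b c : ℕ) : ℝ) * 1 := (mul_one _).symm
      _ ≤ ((rad a b c : ℕ) : ℝ) * (d : ℝ) ^ 2 := by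
          refine mul_le_mul_of_nonneg_left ?_ hr0.le
          nlinarith
      _ ≤ X := hW1
  · have h4 : Real.log ((rad a b c : ℕ) : ℝ) ≤ Real.log (c : ℝ) * (6 / κ) := by
      rw [← mul_div_assoc, le_div_iff₀ hκ0]
      exact key2
    calc ((rad a b c : ℕ) : ℝ) = Real.exp (Real.log ((rad a b c : ℕ) : ℝ)) := (Real.exp_log hr0).symm
      _ ≤ Real.exp (Real.log (c : ℝ) * (6 / κ)) := Real.exp_le_exp.mpr h4
      _ = (c : ℝ) ^ (6 / κ) := (Real.rpow_def_of_pos hc0 _).symm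

/-! ## `MazurKaneLaw` in finset form -/

/-- The set of abc triples with `c ≤ N` and `rad(abc) ≤ c^s` is finite, so `MazurKaneLaw` bounds the
cardinality of every finset of such triples: `#G ≤ C N^{s-1+ε}` with `C ≥ 0`. [folklore] -/
theorem finset_card_le_of_mazurKaneLaw
    (hMK : Summit.ABC.ABC.Theses.TwistAmplification.MazurKaneLaw) {s ε : ℝ} (hs1 : 1 < s)
    (hs2 : s < 2) (hε : 0 < ε) :
    ∃ C : ℝ, 0 ≤ C ∧ ∀ N : ℕ, 2 ≤ N → ∀ G : Finset (ℕ × ℕ × ℕ),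
      (∀ T ∈ G, IsABCTriple T.1 T.2.1 T.2.2 ∧ T.2.2 ≤ N ∧
        ((rad T.1 T.2.1 T.2.2 : ℕ) : ℝ) ≤ (T.2.2 : ℝ) ^ s) →
      (G.card : ℝ) ≤ C * (N : ℝ) ^ (s - 1 + ε) := by
  obtain ⟨C, hC⟩ := hMK s hs1 hs2 ε hε
  refine ⟨max C 0, le_max_right _ _, fun N hN G hG => ?_⟩
  set MK : Set (ℕ × ℕ × ℕ) := {t : ℕ × ℕ × ℕ | IsABCTriple t.1 t.2.1 t.2.2 ∧ t.2.2 ≤ N ∧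
      ((rad t.1 t.2.1 t.2.2 : ℕ) : ℝ) ≤ (t.2.2 : ℝ) ^ s} with hMKdef
  have hfin : MK.Finite := by
    refine Set.Finite.subset
      (Finset.finite_toSet (Finset.range (N + 1) ×ˢ Finset.range (N + 1) ×ˢ Finset.range (N + 1))) ?_
    intro t ht
    obtain ⟨⟨ha, hb, habc, -⟩, hcN, -⟩ := ht
    simp only [Finset.coe_product, Finset.coe_range, Set.mem_prod, Set.mem_Iio]
    omega
  have hsub : (G : Set (ℕ × ℕ × ℕ)) ⊆ MK := fun T hT => hG T hT
  calc (G.card : ℝ) = ((G : Set (ℕ × ℕ × ℕ)).ncard : ℝ) := by rw [Set.ncard_coe_finset]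
    _ ≤ (MK.ncard : ℝ) := by exact_mod_cast Set.ncard_le_ncard hsub hfin
    _ ≤ C * (N : ℝ) ^ (s - 1 + ε) := hC N hN
    _ ≤ max C 0 * (N : ℝ) ^ (s - 1 + ε) :=
        mul_le_mul_of_nonneg_right (le_max_left _ _) (by positivity)

end SharpCountSandwich

set_option maxHeartbeats 400000 in
open SharpCountSandwich in
/-- **The sandwich** (item stmt-ABC-2793 of route TwistAmplification): `ABC → MazurKaneLaw →` for every
`3 < κ < 6 < σ` and `ε > 0` there is `C` with `#S ≤ C X^{1-κ/6+ε}` for every `X ≥ 1` and every finite set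
`S` of Frey–twist window data `(a,b,c,d)` (`(a,b,c)` abc triple, `d = 1` or prime, `d ∤ abc`,
`rad(abc) d² ≤ X`, `κ log(rad(abc) d²) ≤ 6 log(cd) ≤ σ log(rad(abc) d²)`). The upper window bound, the
primality and the coprimality of `d` are not used. [folklore] -/
theorem SharpCountSandwich_proof : Summit.ABC.ABC.Theses.TwistAmplification.SharpCountSandwich := by
  intro hABC hMK κ σ hκ3 hκ6 _hσ ε hε
  classical
  have hκ0 : (0 : ℝ) < κ := by linarith
  -- the small parameter `ε₁` (= `τ`, and `≥ δ`)
  set ε₁ : ℝ := min ε 1 / 16 with hε₁_def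
  have hε₁0 : 0 < ε₁ := by
    have : 0 < min ε 1 := lt_min hε one_pos
    positivity
  have hε₁ε : 16 * ε₁ ≤ ε := by
    have : min ε 1 ≤ ε := min_le_left ε 1
    rw [hε₁_def]
    linarith
  have hε₁1 : ε₁ ≤ 1 / 16 := by
    have : min ε 1 ≤ 1 := min_le_right ε 1
    rw [hε₁_def]
    linarith
  -- the abc constant
  obtain ⟨K₀, _hK₀, hK₀⟩ := hABC ε₁ hε₁0
  set K : ℝ := max K₀ 2 with hK_def
  have hK2 : (2 : ℝ) ≤ K := le_max_right _ _
  have hK1 : (1 : ℝ) ≤ K := by linarith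
  have hABC' : ∀ a b c : ℕ, IsABCTriple a b c →
      (c : ℝ) ≤ K * ((rad a b c : ℕ) : ℝ) ^ (1 + ε₁) := fun a b c h =>
    (hK₀ a b c h).le.trans
      (mul_le_mul_of_nonneg_right (le_max_left _ _) (Real.rpow_nonneg (Nat.cast_nonneg _) _))
  -- the grid of Mazur–Kane exponents `s_k = 1 + kδ`, `k = 1, …, m`, `1 + mδ = 6/κ`
  have hsmax1 : (1 : ℝ) < 6 / κ := by rw [lt_div_iff₀ hκ0]; linarith
  have hsmax2 : 6 / κ < (2 : ℝ) := by rw [div_lt_iff₀ hκ0]; linarith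
  set m : ℕ := ⌈(6 / κ - 1) / ε₁⌉₊ with hm_def
  have hm1 : 1 ≤ m := Nat.ceil_pos.mpr (div_pos (by linarith) hε₁0)
  have hmpos : (0 : ℝ) < (m : ℝ) := by exact_mod_cast hm1
  set δ : ℝ := (6 / κ - 1) / m with hδ_def
  have hδ0 : 0 < δ := div_pos (by linarith) hmpos
  have hmδ : (m : ℝ) * δ = 6 / κ - 1 := by
    rw [hδ_def]
    field_simp
  have hmδ1 : (m : ℝ) * δ ≤ 1 := by linarith
  have hδε₁ : δ ≤ ε₁ := by
    have h : (6 / κ - 1) / ε₁ ≤ (m : ℝ) := Nat.le_ceil _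
    rw [div_le_iff₀ hε₁0] at h
    rw [hδ_def, div_le_iff₀ hmpos]
    linarith
  -- Mazur–Kane constants at the levels
  have hlevC : ∀ k : ℕ, ∃ C : ℝ, 0 ≤ C ∧ (1 ≤ k → k ≤ m → ∀ N : ℕ, 2 ≤ N →
      ∀ G : Finset (ℕ × ℕ × ℕ),
        (∀ T ∈ G, IsABCTriple T.1 T.2.1 T.2.2 ∧ T.2.2 ≤ N ∧
          ((rad T.1 T.2.1 T.2.2 : ℕ) : ℝ) ≤ (T.2.2 : ℝ) ^ (1 + k * δ)) →
        (G.card : ℝ) ≤ C * (N : ℝ) ^ (k * δ + ε₁)) := by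
    intro k
    by_cases hk : 1 ≤ k ∧ k ≤ m
    · have hk1 : (1 : ℝ) ≤ (k : ℝ) := by exact_mod_cast hk.1
      have hkm : (k : ℝ) ≤ (m : ℝ) := by exact_mod_cast hk.2
      have hs1 : (1 : ℝ) < 1 + (k : ℝ) * δ := by nlinarith
      have hs2 : 1 + (k : ℝ) * δ < 2 := by nlinarith
      obtain ⟨C, hC0, hC⟩ := finset_card_le_of_mazurKaneLaw hMK hs1 hs2 hε₁0
      refine ⟨C, hC0, fun _ _ N hN G hG => ?_⟩
      have h := hC N hN G hG
      rwa [show 1 + (k : ℝ) * δ - 1 + ε₁ = k * δ + ε₁ by ring] at h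
    · exact ⟨0, le_rfl, fun h1 h2 => absurd ⟨h1, h2⟩ hk⟩
  choose Cf hCf0 hCf using hlevC
  set A : ℝ := ∑ k ∈ Finset.range (m + 1), Cf k with hA_def
  have hA0 : 0 ≤ A := Finset.sum_nonneg fun k _ => hCf0 k
  have hCfA : ∀ k : ℕ, k ≤ m → Cf k ≤ A := fun k hk =>
    Finset.single_le_sum (fun k _ => hCf0 k) (Finset.mem_range.mpr (Nat.lt_succ_of_le hk))
  have hMK' : ∀ k : ℕ, 1 ≤ k → k ≤ m → ∀ N : ℕ, 2 ≤ N → ∀ G : Finset (ℕ × ℕ × ℕ),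
      (∀ T ∈ G, IsABCTriple T.1 T.2.1 T.2.2 ∧ T.2.2 ≤ N ∧
        ((rad T.1 T.2.1 T.2.2 : ℕ) : ℝ) ≤ (T.2.2 : ℝ) ^ (1 + k * δ)) →
      (G.card : ℝ) ≤ A * (N : ℝ) ^ (k * δ + ε₁) := fun k hk1 hkm N hN G hG =>
    (hCf k hk1 hkm N hN G hG).trans (mul_le_mul_of_nonneg_right (hCfA k hkm) (by positivity))
  -- the constant
  refine ⟨(m : ℝ) * (4 * A * K * (2 / ε₁ + 1)) * (2 * K) ^ (4 * ε₁), ?_⟩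
  intro X hX S hS
  have hX0 : (0 : ℝ) < X := by linarith
  -- `Y = K X^{1+ε₁}` bounds every `c`; `N₀ = ⌊Y⌋ + 1`
  set Y : ℝ := K * X ^ (1 + ε₁) with hY_def
  have hXpow : (1 : ℝ) ≤ X ^ (1 + ε₁) := Real.one_le_rpow hX (by linarith)
  have hY2 : (2 : ℝ) ≤ Y := by rw [hY_def]; nlinarith
  set N₀ : ℕ := ⌊Y⌋₊ + 1 with hN₀_def
  have hN₀Y : Y < (N₀ : ℝ) := by
    rw [hN₀_def]
    push_cast
    exact Nat.lt_floor_add_one Y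
  have hN₀2Y : (N₀ : ℝ) ≤ 2 * Y := by
    rw [hN₀_def]
    push_cast
    have := Nat.floor_le (show (0 : ℝ) ≤ Y by linarith)
    linarith
  have hN₀2 : 2 ≤ N₀ := by
    have : 1 ≤ ⌊Y⌋₊ := Nat.le_floor (by push_cast; linarith)
    omega
  have hN₀1 : (1 : ℝ) ≤ (N₀ : ℝ) := by exact_mod_cast (by omega : 1 ≤ N₀)
  have hN₀0 : (0 : ℝ) < (N₀ : ℝ) := by linarith
  -- pointwise facts for the data
  have hdat : ∀ t ∈ S, IsABCTriple t.1 t.2.1 t.2.2.1 ∧ 1 ≤ t.2.2.2 ∧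
      ((t.2.2.2 : ℝ) ≤ X ^ (1 - κ / 6) * (t.2.2.1 : ℝ) / ((rad t.1 t.2.1 t.2.2.1 : ℕ) : ℝ) ∧
        ((rad t.1 t.2.1 t.2.2.1 : ℕ) : ℝ) ≤ X ∧
        ((rad t.1 t.2.1 t.2.2.1 : ℕ) : ℝ) ≤ (t.2.2.1 : ℝ) ^ (6 / κ)) := by
    intro t ht
    obtain ⟨habc, hd, -, hW1, hW2, -⟩ := hS t ht
    have hd1 : 1 ≤ t.2.2.2 := by
      rcases hd with h | h
      · omega
      · exact h.one_lt.le
    exact ⟨habc, hd1, datum_bounds hκ3 hκ6 hX habc hd1 hW1 hW2⟩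
  -- Step 1: fibre over the triple
  set F : Finset (ℕ × ℕ × ℕ) := S.image (fun t => (t.1, t.2.1, t.2.2.1)) with hF_def
  have hstep1 : (S.card : ℝ) ≤
      ∑ T ∈ F, X ^ (1 - κ / 6) * ((T.2.2 : ℝ) / ((rad T.1 T.2.1 T.2.2 : ℕ) : ℝ)) := by
    refine card_le_sum_image_of_fiber_bound S (fun t => (t.1, t.2.1, t.2.2.1)) (fun t => t.2.2.2)
      (fun T => X ^ (1 - κ / 6) * ((T.2.2 : ℝ) / ((rad T.1 T.2.1 T.2.2 : ℕ) : ℝ))) ?_ ?_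
    · rintro ⟨a, b, c, d⟩ - ⟨a', b', c', d'⟩ - h1 h2
      simp only [Prod.mk.injEq] at h1 h2
      obtain ⟨rfl, rfl, rfl⟩ := h1
      subst h2
      rfl
    · intro t ht
      obtain ⟨-, hd1, hdb, -, -⟩ := hdat t ht
      refine ⟨hd1, ?_⟩
      simpa only [mul_div_assoc] using hdb
  -- Step 2: the weighted Mazur–Kane sum
  have hFprop : ∀ T ∈ F, IsABCTriple T.1 T.2.1 T.2.2 ∧ T.2.2 ≤ N₀ ∧
      ((rad T.1 T.2.1 T.2.2 : ℕ) : ℝ) ≤ (T.2.2 : ℝ) ^ (1 + m * δ) := by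
    intro T hT
    obtain ⟨t, ht, rfl⟩ := Finset.mem_image.mp hT
    obtain ⟨habc, -, -, hrX, hrc⟩ := hdat t ht
    refine ⟨habc, ?_, ?_⟩
    · have h1 := hABC' _ _ _ habc
      have h2 : ((rad t.1 t.2.1 t.2.2.1 : ℕ) : ℝ) ^ (1 + ε₁) ≤ X ^ (1 + ε₁) :=
        Real.rpow_le_rpow (Nat.cast_nonneg _) hrX (by linarith)
      have h3 : ((t.2.2.1 : ℕ) : ℝ) < (N₀ : ℝ) := by
        calc ((t.2.2.1 : ℕ) : ℝ) ≤ K * ((rad t.1 t.2.1 t.2.2.1 : ℕ) : ℝ) ^ (1 + ε₁) := h1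
          _ ≤ K * X ^ (1 + ε₁) := mul_le_mul_of_nonneg_left h2 (by linarith)
          _ < (N₀ : ℝ) := hN₀Y
      exact_mod_cast h3.le
    · rw [hmδ, show (1 : ℝ) + (6 / κ - 1) = 6 / κ by ring]
      exact hrc
  have hstep2 := level_sum_le hδ0 hε₁0.le (by linarith) hε₁0.le hA0 hK1 hm1 hmδ1 hN₀2 hMK' hABC'
    F hFprop
  -- Step 3: numerical clean-up
  set J : ℕ := Nat.log 2 N₀ with hJ_def
  have hJ : ((J : ℝ) + 1) ≤ (2 / ε₁ + 1) * (N₀ : ℝ) ^ ε₁ := by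
    have h2J : (2 : ℝ) ^ J ≤ (N₀ : ℝ) := by
      have := Nat.pow_log_le_self 2 (x := N₀) (by omega)
      rw [← hJ_def] at this
      exact_mod_cast this
    have hlog : (J : ℝ) * Real.log 2 ≤ Real.log (N₀ : ℝ) := by
      rw [← Real.log_pow]
      exact Real.log_le_log (by positivity) h2J
    have hlog2 : (1 / 2 : ℝ) < Real.log 2 := by
      have := Real.log_two_gt_d9
      linarith
    have hJ0 : (0 : ℝ) ≤ (J : ℝ) := Nat.cast_nonneg J
    have hJle : (J : ℝ) ≤ 2 * Real.log (N₀ : ℝ) := by nlinarith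
    have hlogle : Real.log (N₀ : ℝ) ≤ (N₀ : ℝ) ^ ε₁ / ε₁ := Real.log_le_rpow_div hN₀0.le hε₁0
    have hone : (1 : ℝ) ≤ (N₀ : ℝ) ^ ε₁ := Real.one_le_rpow hN₀1 hε₁0.le
    calc (J : ℝ) + 1 ≤ 2 * ((N₀ : ℝ) ^ ε₁ / ε₁) + (N₀ : ℝ) ^ ε₁ := by linarith
      _ = (2 / ε₁ + 1) * (N₀ : ℝ) ^ ε₁ := by
          field_simp
  have hNexp : (N₀ : ℝ) ^ ε₁ * (N₀ : ℝ) ^ (ε₁ + δ + ε₁) ≤ (2 * K) ^ (4 * ε₁) * X ^ ε := by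
    rw [← Real.rpow_add hN₀0]
    calc (N₀ : ℝ) ^ (ε₁ + (ε₁ + δ + ε₁)) ≤ (N₀ : ℝ) ^ (4 * ε₁) :=
          Real.rpow_le_rpow_of_exponent_le hN₀1 (by linarith)
      _ ≤ (2 * Y) ^ (4 * ε₁) := Real.rpow_le_rpow hN₀0.le hN₀2Y (by linarith)
      _ = (2 * K) ^ (4 * ε₁) * X ^ ((1 + ε₁) * (4 * ε₁)) := by
          rw [hY_def, ← mul_assoc, Real.mul_rpow (by linarith) (by positivity),
            Real.rpow_mul hX0.le]
      _ ≤ (2 * K) ^ (4 * ε₁) * X ^ ε := by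
          refine mul_le_mul_of_nonneg_left ?_ (by positivity)
          refine Real.rpow_le_rpow_of_exponent_le hX ?_
          nlinarith
  have hsum0 : 0 ≤ ∑ T ∈ F, (T.2.2 : ℝ) / ((rad T.1 T.2.1 T.2.2 : ℕ) : ℝ) :=
    Finset.sum_nonneg fun T _ => by positivity
  calc (S.card : ℝ)
      ≤ ∑ T ∈ F, X ^ (1 - κ / 6) * ((T.2.2 : ℝ) / ((rad T.1 T.2.1 T.2.2 : ℕ) : ℝ)) := hstep1
    _ = X ^ (1 - κ / 6) * ∑ T ∈ F, (T.2.2 : ℝ) / ((rad T.1 T.2.1 T.2.2 : ℕ) : ℝ) := by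
        rw [Finset.mul_sum]
    _ ≤ X ^ (1 - κ / 6) * ((m : ℝ) * (4 * A * K * ((J : ℝ) + 1) * (N₀ : ℝ) ^ (ε₁ + δ + ε₁))) :=
        mul_le_mul_of_nonneg_left hstep2 (by positivity)
    _ ≤ X ^ (1 - κ / 6) *
          ((m : ℝ) * (4 * A * K * ((2 / ε₁ + 1) * (N₀ : ℝ) ^ ε₁) * (N₀ : ℝ) ^ (ε₁ + δ + ε₁))) := by
        gcongr
    _ = X ^ (1 - κ / 6) * ((m : ℝ) * (4 * A * K * (2 / ε₁ + 1))) *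
          ((N₀ : ℝ) ^ ε₁ * (N₀ : ℝ) ^ (ε₁ + δ + ε₁)) := by ring
    _ ≤ X ^ (1 - κ / 6) * ((m : ℝ) * (4 * A * K * (2 / ε₁ + 1))) *
          ((2 * K) ^ (4 * ε₁) * X ^ ε) :=
        mul_le_mul_of_nonneg_left hNexp (by positivity)
    _ = (m : ℝ) * (4 * A * K * (2 / ε₁ + 1)) * (2 * K) ^ (4 * ε₁) * X ^ (1 - κ / 6 + ε) := by
        rw [Real.rpow_add hX0]
        ring

end Summit.ABC.ABC.Theorems
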